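import Literature.NumberTheory.Sieve.IwaniecAlmostPrimesHooley
import Literature.NumberTheory.LFunctions.IncompleteKloostermanSmooth
import HarnessLib

/-!
# Incomplete Kloosterman sums over an interval in an arithmetic progression (Weil + completion)

Topic `NumberTheory/LFunctions` (exponential sums).  The classical completion estimate for
`∑_{x ∈ I, x ≡ v (mod q), (x, s) = 1} e(a x̄ / s)`, `x̄ x ≡ 1 (mod s)`, `(q, s) = 1`, `I` an interval
of any length, with the sharp zero-frequency term (a Ramanujan sum): S. Bettin, V. Chandee,
*Trilinear forms with Kloosterman fractions*, Adv. Math. 328 (2018), Appendix, Lemma 1, first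
display (kseq), case `h = (k, γ) = 1`, `δ = 1` (their `γ, k, α` are our `s, q, a`):
"applying the Erdős–Turán inequality as in Lemma 8 of [DFI97], we find
`|∑_{x∈I,(x,γ)=1} e(α x̄/γ)| ≤ (X + k)/(γk) |S(α,0;γ)| + ∑_{1≤r≤γ/2} r⁻¹ |S(α, r k̄; γ)|`. Thus, using
Weil's bound … and observing that `|S(α,0;γ)|` is a Ramanujan sum and thus is bounded by
`(α, γ)`, we obtain (kseq)."  Here everything is PROVED with explicit constants, from the tree's
PROVED Weil bound (`weil_kloosterman_bound_holds`), the Ramanujan-sum bound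
`MatomakiMerikoski.norm_kloostermanSum_zero_left_le`, and the completion machinery of
`Sieve/IwaniecAlmostPrimesHooley.lean` (finite Fourier inversion on `ℤ/sℤ`, the transform is a
Kloosterman sum, geometric sums against well-spaced points):

* `KI_sum_progression_le` — writing the progression as `x = v + q y`, `y₁ < y ≤ y₂`:
  `‖∑_{y₁<y≤y₂, (v+qy, s)=1} e(a · (v+qy)‾ / s)‖ ≤ ((y₂ − y₁)/s) (a, s) + τ(s) s^{1/2} (a, s)^{1/2} (1 + log s)`.
* `KI_sum_progression_coprime_le` — the same with an extra condition `(v + qy, δ) = 1`, `(δ, q) = 1`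
  (the source's `δ`, by Möbius inversion over `r ∣ δ`), at the cost of a factor `τ(δ)` and of
  `y₂ − y₁ + 1` in place of `y₂ − y₁`.

Proof.  `G(u) = [u unit] e_s(a u⁻¹)` on `ℤ/sℤ` has transform `Ĝ(t) = S(−t, a; s)`;
`G(w) = s⁻¹ ∑_t Ĝ(t) e_s(tw)`, so the sum is `s⁻¹ ∑_t Ĝ(t) e_s(tv) ∑_y e_s((tq) y)`.  The term
`t = 0` is `s⁻¹ c_s(a) (y₂ − y₁)`, `|c_s(a)| ≤ (a, s)`; for `t ≠ 0`, `|Ĝ(t)| ≤ τ(s) √s √(a,s)`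
(Weil) and, `t ↦ tq` permuting the nonzero residues (`(q, s) = 1`),
`∑_{t≠0} |∑_y e_s((tq)y)| ≤ ∑_{w=1}^{s−1} 1/(2‖w/s‖) ≤ s (1 + log s)`.

## References

* S. Bettin, V. Chandee, Adv. Math. 328 (2018) 1234–1262 (arXiv:1502.00769), Appendix, Lemma 1
  (kseq) and its proof. [BettinChandee2018]
* W. Duke, J. Friedlander, H. Iwaniec, Invent. Math. 128 (1997) 23–43, Lemma 8.
  [DukeFriedlanderIwaniec1997]
* H. Iwaniec, *Spectral Methods of Automorphic Forms*, 2nd ed. (2002), §2.5 (2.25) (Weil's bound).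
  [Iwaniec2002]
-/

noncomputable section

open Finset
open scoped FourierTransform

namespace Literature.NumberTheory.LFunctions

open Literature.NumberTheory.Sieve.Iwaniec1978 (hooley_term_eq_stdAddChar hooley_gcd_eq_one_iff_isUnit
  hooley_fourier_inversion hooley_transform_eq_kloostermanSum hooley_norm_kloostermanSum_le
  hooley_norm_sum_range_fourierChar_le hooley_separated)
open Literature.NumberTheory.Sieve.Vinogradov (distInt geomBound distInt_nonneg geomBound_nonneg
  geomBound_le geomBound_le_inv sum_inv_distInt_le_of_separated)
open Literature.NumberTheory.LFunctions.MatomakiMerikoski (norm_kloostermanSum_zero_left_le)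

/-- `e_s(w · y) = e(y · (w.val / s))` for an integer `y` and `w ∈ ℤ/sℤ`. [folklore] -/
theorem KI_stdAddChar_mul_intCast {s : ℕ} [NeZero s] (w : ZMod s) (y : ℤ) :
    (ZMod.stdAddChar (w * (y : ZMod s)) : ℂ) = (𝐞 ((y : ℝ) * ((w.val : ℝ) / s)) : ℂ) := by
  have hw : w * (y : ZMod s) = (((w.val : ℤ) * y : ℤ) : ZMod s) := by
    push_cast; rw [ZMod.natCast_zmod_val]
  rw [hw, ZMod.stdAddChar_coe, Real.fourierChar_apply]
  congr 1
  have hs : (s : ℂ) ≠ 0 := Nat.cast_ne_zero.mpr (NeZero.ne s)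
  push_cast
  field_simp

/-- The Ramanujan-sum bound for the zero frequency: `|S(0, a; s)| ≤ (a, s)`. [folklore] -/
theorem KI_norm_kloostermanSum_zero_le (s : ℕ) [NeZero s] (a : ℤ) :
    ‖kloostermanSum s 0 (a : ZMod s)‖ ≤ Int.gcd a s := by
  refine (norm_kloostermanSum_zero_left_le s (a : ZMod s)).trans (le_of_eq ?_)
  have h1 : ((((a : ZMod s).val : ℕ) : ℤ)).gcd (s : ℤ) = Int.gcd a s := by
    rw [ZMod.val_intCast, Int.gcd_emod]
  have h2 : Nat.gcd (a : ZMod s).val s = Int.gcd a s := by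
    rw [← h1, Int.gcd_natCast_natCast]
  exact_mod_cast h2

/-- The nonzero residues `w mod s` give `1/s`-separated points `w/s`, each at distance `≥ 1/s`
from `ℤ`; hence `∑_{w ≠ 0} 1/(2‖w/s‖) ≤ s (1 + log s)`. [folklore] -/
theorem KI_sum_inv_distInt_le (s : ℕ) [NeZero s] :
    ∑ w ∈ (Finset.univ : Finset (ZMod s)).erase 0, 1 / (2 * distInt (((w.val : ℕ) : ℝ) / s)) ≤
      (s : ℝ) * (1 + Real.log s) := by
  have hs : 0 < s := Nat.pos_of_ne_zero (NeZero.ne s)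
  have hs0 : (0 : ℝ) < s := by exact_mod_cast hs
  have hδ : (0 : ℝ) < 1 / s := by positivity
  have hm : 1 / (2 * (1 / (s : ℝ))) ≤ (s : ℕ) := by
    rw [show 1 / (2 * (1 / (s : ℝ))) = s / 2 by field_simp]
    linarith
  have hsep0 := hooley_separated hs (0 : ℝ)
  have hsep : ∀ w ∈ (Finset.univ : Finset (ZMod s)).erase 0, ∀ w' ∈ (Finset.univ : Finset (ZMod s)).erase 0,
      w ≠ w' → 1 / (s : ℝ) ≤ distInt ((((w.val : ℕ) : ℝ) / s) - (((w'.val : ℕ) : ℝ) / s)) := by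
    intro w _ w' _ hne
    have hv : w.val ≠ w'.val := fun h => hne (ZMod.val_injective s h)
    have := hsep0 w.val (Finset.mem_range.mpr (ZMod.val_lt w)) w'.val
      (Finset.mem_range.mpr (ZMod.val_lt w')) hv
    simpa using this
  have hfar : ∀ w ∈ (Finset.univ : Finset (ZMod s)).erase 0,
      1 / (s : ℝ) ≤ distInt (((w.val : ℕ) : ℝ) / s) := by
    intro w hw
    have hw0 : w ≠ 0 := Finset.ne_of_mem_erase hw
    have hv : w.val ≠ 0 := fun h => hw0 ((ZMod.val_eq_zero w).mp h)
    have := hsep0 w.val (Finset.mem_range.mpr (ZMod.val_lt w)) 0 (Finset.mem_range.mpr hs) hv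
    simpa using this
  have h := sum_inv_distInt_le_of_separated ((Finset.univ : Finset (ZMod s)).erase 0)
    (fun w : ZMod s => ((w.val : ℕ) : ℝ) / s) hδ hm hsep hfar
  simpa using h

/-- **Incomplete Kloosterman sums over an interval in a progression** (Bettin–Chandee, Appendix
Lemma 1 (kseq), case `(k, γ) = 1`, `δ = 1`; DFI 1997 Lemma 8): for `s ≥ 1`, `(q, s) = 1`,
integers `a, v` and `y₁ ≤ y₂`,
`‖∑_{y₁ < y ≤ y₂, (v + qy, s) = 1} e(a (v + qy)‾ / s)‖ ≤ ((y₂ − y₁)/s)(a, s) + τ(s) √s √(a, s) (1 + log s)`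
(`x̄` the inverse modulo `s`, `τ` the divisor function). [cite: BettinChandee2018, Appendix Lemma 1] -/
theorem KI_sum_progression_le {s : ℕ} (hs : 0 < s) {q : ℕ} (hqs : q.Coprime s) (a v y₁ y₂ : ℤ)
    (hy : y₁ ≤ y₂) :
    ‖∑ y ∈ (Finset.Ioc y₁ y₂).filter (fun y : ℤ => Int.gcd (v + q * y) s = 1),
        Complex.exp (2 * Real.pi * Complex.I *
          ((a : ℂ) * (((((v + q * y : ℤ) : ZMod s)⁻¹).val : ℕ) : ℂ) / (s : ℂ)))‖ ≤
      ((y₂ - y₁ : ℤ) : ℝ) / s * Int.gcd a s +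
        (Nat.divisors s).card * Real.sqrt s * Real.sqrt (Int.gcd a s) * (1 + Real.log s) := by
  classical
  haveI : NeZero s := ⟨hs.ne'⟩
  have hs0 : (0 : ℝ) < s := by exact_mod_cast hs
  have hsC : (s : ℂ) ≠ 0 := Nat.cast_ne_zero.mpr hs.ne'
  -- notation
  set ψ : AddChar (ZMod s) ℂ := ZMod.stdAddChar with hψ
  set G : ZMod s → ℂ := fun u => if IsUnit u then (ψ ((a : ZMod s) * u⁻¹) : ℂ) else 0 with hG
  set Gh : ZMod s → ℂ := fun t => ∑ u : ZMod s, G u * (ψ (-(t * u)) : ℂ) with hGh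
  set B : ℝ := (Nat.divisors s).card * Real.sqrt s * Real.sqrt (Int.gcd a s) with hB
  have hB0 : 0 ≤ B := by positivity
  have hGh_le : ∀ t, ‖Gh t‖ ≤ B := by
    intro t
    have := hooley_norm_kloostermanSum_le weil_kloosterman_bound_holds t a
    rw [← hooley_transform_eq_kloostermanSum] at this
    exact this
  have hGh0 : ‖Gh 0‖ ≤ Int.gcd a s := by
    have h1 : Gh 0 = kloostermanSum s 0 (a : ZMod s) := by
      rw [hGh]
      simp only
      rw [hooley_transform_eq_kloostermanSum, neg_zero]
    rw [h1]
    exact KI_norm_kloostermanSum_zero_le s a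
  -- the run `y₁ < y ≤ y₂` as `y₁ + 1 + n`, `n < K`
  obtain ⟨K, hK⟩ : ∃ K : ℕ, (K : ℤ) = y₂ - y₁ := ⟨(y₂ - y₁).toNat, by omega⟩
  set rr : ℕ → ℤ := fun n => y₁ + 1 + (n : ℤ) with hrr
  have hIoc : Finset.Ioc y₁ y₂ = (Finset.range K).map ⟨rr, fun i j hij => by
      simp only [hrr] at hij; exact_mod_cast (add_left_cancel hij)⟩ := by
    ext m
    simp only [Finset.mem_Ioc, Finset.mem_map, Finset.mem_range, Function.Embedding.coeFn_mk, hrr]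
    constructor
    · rintro ⟨h1, h2⟩
      refine ⟨(m - y₁ - 1).toNat, ?_, ?_⟩ <;> omega
    · rintro ⟨n, hn, rfl⟩; omega
  -- Step 1: the summand through `G`
  have hstep1 : ∀ y : ℤ,
      (if Int.gcd (v + q * y) s = 1 then
        Complex.exp (2 * Real.pi * Complex.I *
          ((a : ℂ) * (((((v + q * y : ℤ) : ZMod s)⁻¹).val : ℕ) : ℂ) / (s : ℂ))) else 0) =
      G ((v + q * y : ℤ) : ZMod s) := by
    intro y
    by_cases hg : Int.gcd (v + q * y) s = 1
    · rw [if_pos hg, hooley_term_eq_stdAddChar]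
      simp only [hG, hψ]
      rw [if_pos ((hooley_gcd_eq_one_iff_isUnit _).mp hg)]
    · rw [if_neg hg]
      simp only [hG]
      rw [if_neg (fun hu => hg ((hooley_gcd_eq_one_iff_isUnit _).mpr hu))]
  -- Step 2: Fourier inversion `G(w) = s⁻¹ ∑_t Ĝ(t) e_s(t w)`
  have hGinv : ∀ w : ZMod s, G w = (s : ℂ)⁻¹ * ∑ t : ZMod s, Gh t * (ψ (t * w) : ℂ) := by
    intro w
    have hinv := hooley_fourier_inversion G w
    rw [hGh, hψ, hinv, ← mul_assoc, inv_mul_cancel₀ hsC, one_mul]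
  -- the geometric sums `T(w) = ∑_y e_s(w y)`
  set T : ZMod s → ℂ := fun w => ∑ n ∈ Finset.range K, (ψ (w * (rr n : ZMod s)) : ℂ) with hT
  have hT_le : ∀ w : ZMod s, ‖T w‖ ≤ geomBound K (((w.val : ℕ) : ℝ) / s) := by
    intro w
    rw [hT]
    simp only
    simp_rw [hψ, KI_stdAddChar_mul_intCast]
    exact hooley_norm_sum_range_fourierChar_le y₁ _ le_rfl
  have hT0 : T 0 = K := by
    rw [hT]
    simp
  -- Step 3: the sum equals `s⁻¹ ∑_t Ĝ(t) e_s(t v) T(t q)`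
  have hS_eq : ∑ y ∈ (Finset.Ioc y₁ y₂).filter (fun y : ℤ => Int.gcd (v + q * y) s = 1),
      Complex.exp (2 * Real.pi * Complex.I *
        ((a : ℂ) * (((((v + q * y : ℤ) : ZMod s)⁻¹).val : ℕ) : ℂ) / (s : ℂ))) =
      (s : ℂ)⁻¹ * ∑ t : ZMod s, Gh t * (ψ (t * (v : ZMod s)) : ℂ) * T (t * (q : ZMod s)) := by
    rw [Finset.sum_filter, hIoc, Finset.sum_map]
    simp only [Function.Embedding.coeFn_mk]
    simp_rw [hstep1, hGinv, ← Finset.mul_sum]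
    congr 1
    rw [Finset.sum_comm]
    refine Finset.sum_congr rfl fun t _ => ?_
    rw [hT]
    simp only
    rw [Finset.mul_sum]
    refine Finset.sum_congr rfl fun n _ => ?_
    have hsplit : t * (((v + q * rr n : ℤ)) : ZMod s) =
        t * (v : ZMod s) + t * (q : ZMod s) * (rr n : ZMod s) := by
      push_cast; ring
    rw [hsplit, AddChar.map_add_eq_mul]
    ring
  -- Step 4: split off `t = 0` and bound
  rw [hS_eq, ← Finset.add_sum_erase _ _ (Finset.mem_univ (0 : ZMod s)), mul_add]
  refine (norm_add_le _ _).trans (add_le_add ?_ ?_)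
  · -- the zero frequency: `s⁻¹ |Ĝ(0)| K ≤ ((y₂ - y₁)/s) (a, s)`
    simp only [zero_mul, AddChar.map_zero_eq_one, mul_one]
    rw [hT0, norm_mul, norm_inv, Complex.norm_natCast, norm_mul, Complex.norm_natCast]
    have hKr : (K : ℝ) = ((y₂ - y₁ : ℤ) : ℝ) := by exact_mod_cast hK
    rw [← hKr]
    calc (s : ℝ)⁻¹ * (‖Gh 0‖ * K) ≤ (s : ℝ)⁻¹ * ((Int.gcd a s : ℝ) * K) := by gcongr
      _ = (K : ℝ) / s * Int.gcd a s := by field_simp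
  · -- the nonzero frequencies
    rw [norm_mul, norm_inv, Complex.norm_natCast]
    have hq : IsUnit ((q : ℕ) : ZMod s) := (ZMod.isUnit_iff_coprime q s).mpr hqs
    -- `t ↦ t q` permutes the nonzero residues
    have hperm : ∑ t ∈ (Finset.univ : Finset (ZMod s)).erase 0,
        geomBound K (((((t * (q : ZMod s)).val : ℕ) : ℝ)) / s) =
        ∑ w ∈ (Finset.univ : Finset (ZMod s)).erase 0, geomBound K ((((w.val : ℕ) : ℝ)) / s) := by
      refine Finset.sum_nbij' (fun t => t * (q : ZMod s)) (fun w => w * (q : ZMod s)⁻¹)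
        (fun t ht => ?_) (fun w hw => ?_) (fun t _ => ?_) (fun w _ => ?_) (fun t _ => rfl)
      · rw [Finset.mem_erase] at ht ⊢
        refine ⟨fun h0 => ht.1 ?_, Finset.mem_univ _⟩
        have : t * (q : ZMod s) * (q : ZMod s)⁻¹ = 0 := by rw [h0, zero_mul]
        rwa [mul_assoc, ZMod.mul_inv_of_unit _ hq, mul_one] at this
      · rw [Finset.mem_erase] at hw ⊢
        refine ⟨fun h0 => hw.1 ?_, Finset.mem_univ _⟩
        have : w * (q : ZMod s)⁻¹ * (q : ZMod s) = 0 := by rw [h0, zero_mul]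
        rwa [mul_assoc, mul_comm ((q : ZMod s)⁻¹), ZMod.mul_inv_of_unit _ hq, mul_one] at this
      · rw [mul_assoc, ZMod.mul_inv_of_unit _ hq, mul_one]
      · rw [mul_assoc, mul_comm ((q : ZMod s)⁻¹), ZMod.mul_inv_of_unit _ hq, mul_one]
    have hsum : ‖∑ t ∈ (Finset.univ : Finset (ZMod s)).erase 0,
        Gh t * (ψ (t * (v : ZMod s)) : ℂ) * T (t * (q : ZMod s))‖ ≤ B * (s * (1 + Real.log s)) := by
      calc ‖∑ t ∈ (Finset.univ : Finset (ZMod s)).erase 0,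
            Gh t * (ψ (t * (v : ZMod s)) : ℂ) * T (t * (q : ZMod s))‖
          ≤ ∑ t ∈ (Finset.univ : Finset (ZMod s)).erase 0,
            ‖Gh t * (ψ (t * (v : ZMod s)) : ℂ) * T (t * (q : ZMod s))‖ := norm_sum_le _ _
        _ ≤ ∑ t ∈ (Finset.univ : Finset (ZMod s)).erase 0,
            B * geomBound K (((((t * (q : ZMod s)).val : ℕ) : ℝ)) / s) := by
            refine Finset.sum_le_sum fun t _ => ?_
            rw [norm_mul, norm_mul, hψ, ZMod.stdAddChar_apply, Circle.norm_coe, mul_one]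
            exact mul_le_mul (hGh_le t) (hT_le _) (norm_nonneg _) hB0
        _ = B * ∑ w ∈ (Finset.univ : Finset (ZMod s)).erase 0,
            geomBound K ((((w.val : ℕ) : ℝ)) / s) := by rw [← Finset.mul_sum, hperm]
        _ ≤ B * ∑ w ∈ (Finset.univ : Finset (ZMod s)).erase 0,
            1 / (2 * distInt ((((w.val : ℕ) : ℝ)) / s)) := by
            refine mul_le_mul_of_nonneg_left (Finset.sum_le_sum fun w hw => ?_) hB0
            refine geomBound_le_inv _ ?_
            have hw0 : w ≠ 0 := Finset.ne_of_mem_erase hw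
            have hv : w.val ≠ 0 := fun h => hw0 ((ZMod.val_eq_zero w).mp h)
            have := hooley_separated hs (0 : ℝ) w.val (Finset.mem_range.mpr (ZMod.val_lt w)) 0
              (Finset.mem_range.mpr hs) hv
            have h1 : 1 / (s : ℝ) ≤ distInt (((w.val : ℕ) : ℝ) / s) := by simpa using this
            exact lt_of_lt_of_le (by positivity) h1
        _ ≤ B * (s * (1 + Real.log s)) :=
            mul_le_mul_of_nonneg_left (KI_sum_inv_distInt_le s) hB0
    calc (s : ℝ)⁻¹ * ‖∑ t ∈ (Finset.univ : Finset (ZMod s)).erase 0,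
          Gh t * (ψ (t * (v : ZMod s)) : ℂ) * T (t * (q : ZMod s))‖
        ≤ (s : ℝ)⁻¹ * (B * (s * (1 + Real.log s))) := by gcongr
      _ = B * (1 + Real.log s) := by field_simp
      _ = (Nat.divisors s).card * Real.sqrt s * Real.sqrt (Int.gcd a s) * (1 + Real.log s) := by
          rw [hB]


/-! ### An extra coprimality condition `(x, δ) = 1` (Möbius inversion over `r ∣ δ`) -/

/-- `∑_{d ∣ m} μ(d) = [m = 1]` in `ℂ` (Mathlib's `μ * ζ = 1`). [folklore] -/
theorem KI_sum_divisors_moebius (m : ℕ) :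
    ∑ d ∈ m.divisors, (ArithmeticFunction.moebius d : ℂ) = if m = 1 then 1 else 0 := by
  have h := congrArg (fun f : ArithmeticFunction ℂ => f m)
    (ArithmeticFunction.coe_moebius_mul_coe_zeta (R := ℂ))
  simpa only [ArithmeticFunction.coe_mul_zeta_apply, ArithmeticFunction.intCoe_apply,
    ArithmeticFunction.one_apply] using h

/-- Möbius inversion of the coprimality indicator: for `δ ≥ 1` and an integer `x`,
`[(x, δ) = 1] = ∑_{r ∣ δ} μ(r) [r ∣ x]`. [folklore] -/
theorem KI_coprime_indicator_eq_sum_moebius {δ : ℕ} (hδ : 0 < δ) (x : ℤ) :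
    (if Int.gcd x δ = 1 then (1 : ℂ) else 0) =
      ∑ r ∈ δ.divisors, (ArithmeticFunction.moebius r : ℂ) * (if (r : ℤ) ∣ x then 1 else 0) := by
  have hset : δ.divisors.filter (fun r : ℕ => (r : ℤ) ∣ x) = (Int.gcd x δ).divisors := by
    ext r
    simp only [Finset.mem_filter, Nat.mem_divisors, Int.gcd, Nat.mem_divisors, ne_eq,
      Nat.gcd_eq_zero_iff, not_and, Int.natCast_dvd]
    constructor
    · rintro ⟨⟨h1, _⟩, h2⟩
      exact ⟨Nat.dvd_gcd h2 h1, fun _ => hδ.ne'⟩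
    · rintro ⟨h1, _⟩
      exact ⟨⟨(Nat.dvd_trans h1 (Nat.gcd_dvd_right _ _)), hδ.ne'⟩,
        Nat.dvd_trans h1 (Nat.gcd_dvd_left _ _)⟩
  simp_rw [mul_ite, mul_one, mul_zero]
  rw [← Finset.sum_filter, hset, KI_sum_divisors_moebius]

/-- `r ∣ v + q y ↔ y ≡ y₀ (mod r)` with `y₀ = −v q̄`, for `(q, r) = 1`. [folklore] -/
theorem KI_dvd_iff_modEq {r q : ℕ} (hr : 0 < r) (hqr : q.Coprime r) (v y : ℤ) :
    (r : ℤ) ∣ v + q * y ↔ y ≡ -v * ((((q : ZMod r)⁻¹).val : ℕ) : ℤ) [ZMOD r] := by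
  haveI : NeZero r := ⟨hr.ne'⟩
  have hu : IsUnit ((q : ℕ) : ZMod r) := (ZMod.isUnit_iff_coprime q r).mpr hqr
  rw [← ZMod.intCast_zmod_eq_zero_iff_dvd, ← ZMod.intCast_eq_intCast_iff]
  push_cast
  rw [ZMod.natCast_zmod_val]
  constructor
  · intro h
    have h1 : (q : ZMod r) * (y : ZMod r) = -(v : ZMod r) := by linear_combination h
    calc (y : ZMod r) = (q : ZMod r) * (q : ZMod r)⁻¹ * (y : ZMod r) := by
          rw [ZMod.mul_inv_of_unit _ hu, one_mul]
      _ = -(v : ZMod r) * (q : ZMod r)⁻¹ := by rw [mul_assoc, mul_comm _ (y : ZMod r), ← mul_assoc, h1]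
  · intro h
    rw [h]
    calc (v : ZMod r) + (q : ZMod r) * (-(v : ZMod r) * (q : ZMod r)⁻¹)
        = (v : ZMod r) - (v : ZMod r) * ((q : ZMod r) * (q : ZMod r)⁻¹) := by ring
      _ = 0 := by rw [ZMod.mul_inv_of_unit _ hu, mul_one, sub_self]

/-- **The same with an extra coprimality condition** (Bettin–Chandee, Appendix Lemma 1 (kseq), case
`(k, γ) = 1`, general `δ`; their `δ > 1` step "can be easily obtained from the case `δ = 1` by Möbius
inversion"): for `s ≥ 1`, `(q, s) = 1`, `δ ≥ 1` with `(δ, q) = 1`, integers `a, v`, `y₁ ≤ y₂`,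
`‖∑_{y₁<y≤y₂, (v+qy, s)=1, (v+qy, δ)=1} e(a (v+qy)‾/s)‖
   ≤ τ(δ) ( ((y₂ − y₁ + 1)/s) (a, s) + τ(s) √s √(a,s) (1 + log s) )`
(each `r ∣ δ` with `(r, s) = 1` turns `r ∣ v + qy` into a progression `y = y₀ + rz` to which
`KI_sum_progression_le` applies with `q r` in place of `q`; if `(r, s) > 1` the inner sum is empty).
[cite: BettinChandee2018, Appendix Lemma 1] -/
theorem KI_sum_progression_coprime_le {s : ℕ} (hs : 0 < s) {q : ℕ} (hqs : q.Coprime s)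
    {δ : ℕ} (hδ : 0 < δ) (hδq : δ.Coprime q) (a v y₁ y₂ : ℤ) (hy : y₁ ≤ y₂) :
    ‖∑ y ∈ (Finset.Ioc y₁ y₂).filter
        (fun y : ℤ => Int.gcd (v + q * y) s = 1 ∧ Int.gcd (v + q * y) δ = 1),
        Complex.exp (2 * Real.pi * Complex.I *
          ((a : ℂ) * (((((v + q * y : ℤ) : ZMod s)⁻¹).val : ℕ) : ℂ) / (s : ℂ)))‖ ≤
      (Nat.divisors δ).card *
        ((((y₂ - y₁ : ℤ) : ℝ) + 1) / s * Int.gcd a s +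
          (Nat.divisors s).card * Real.sqrt s * Real.sqrt (Int.gcd a s) * (1 + Real.log s)) := by
  classical
  have hs0 : (0 : ℝ) < s := by exact_mod_cast hs
  -- notation for the summand and the bound
  set f : ℤ → ℂ := fun x => Complex.exp (2 * Real.pi * Complex.I *
      ((a : ℂ) * ((((x : ZMod s)⁻¹).val : ℕ) : ℂ) / (s : ℂ))) with hf
  set W : ℝ := (Nat.divisors s).card * Real.sqrt s * Real.sqrt (Int.gcd a s) * (1 + Real.log s)
    with hW
  have hlog : 0 ≤ 1 + Real.log s := by
    have := Real.log_nonneg (show (1 : ℝ) ≤ s by exact_mod_cast hs); linarith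
  have hW0 : 0 ≤ W := by rw [hW]; positivity
  set Bd : ℝ := (((y₂ - y₁ : ℤ) : ℝ) + 1) / s * Int.gcd a s + W with hBd
  have hy0 : (0 : ℝ) ≤ ((y₂ - y₁ : ℤ) : ℝ) := by exact_mod_cast (sub_nonneg.mpr hy)
  have hBd0 : 0 ≤ Bd := by rw [hBd]; positivity
  -- Step 1: Möbius inversion of `(v + qy, δ) = 1` and exchange of summations
  have hstep1 : ∑ y ∈ (Finset.Ioc y₁ y₂).filter
        (fun y : ℤ => Int.gcd (v + q * y) s = 1 ∧ Int.gcd (v + q * y) δ = 1), f (v + q * y) =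
      ∑ r ∈ δ.divisors, (ArithmeticFunction.moebius r : ℂ) *
        ∑ y ∈ (Finset.Ioc y₁ y₂).filter
          (fun y : ℤ => Int.gcd (v + q * y) s = 1 ∧ (r : ℤ) ∣ v + q * y), f (v + q * y) := by
    calc ∑ y ∈ (Finset.Ioc y₁ y₂).filter
          (fun y : ℤ => Int.gcd (v + q * y) s = 1 ∧ Int.gcd (v + q * y) δ = 1), f (v + q * y)
        = ∑ y ∈ (Finset.Ioc y₁ y₂).filter (fun y : ℤ => Int.gcd (v + q * y) s = 1),
            (if Int.gcd (v + q * y) δ = 1 then (1 : ℂ) else 0) * f (v + q * y) := by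
          rw [← Finset.filter_filter, Finset.sum_filter (fun y : ℤ => Int.gcd (v + q * y) δ = 1)]
          refine Finset.sum_congr rfl fun y _ => ?_
          split_ifs <;> simp
      _ = ∑ y ∈ (Finset.Ioc y₁ y₂).filter (fun y : ℤ => Int.gcd (v + q * y) s = 1),
            ∑ r ∈ δ.divisors, (ArithmeticFunction.moebius r : ℂ) *
              ((if (r : ℤ) ∣ v + q * y then 1 else 0) * f (v + q * y)) := by
          refine Finset.sum_congr rfl fun y _ => ?_
          rw [KI_coprime_indicator_eq_sum_moebius hδ, Finset.sum_mul]
          refine Finset.sum_congr rfl fun r _ => ?_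
          ring
      _ = ∑ r ∈ δ.divisors, (ArithmeticFunction.moebius r : ℂ) *
            ∑ y ∈ (Finset.Ioc y₁ y₂).filter (fun y : ℤ => Int.gcd (v + q * y) s = 1),
              (if (r : ℤ) ∣ v + q * y then 1 else 0) * f (v + q * y) := by
          rw [Finset.sum_comm]
          refine Finset.sum_congr rfl fun r _ => ?_
          rw [Finset.mul_sum]
      _ = _ := by
          refine Finset.sum_congr rfl fun r _ => ?_
          congr 1
          rw [← Finset.filter_filter, Finset.sum_filter (fun y : ℤ => (r : ℤ) ∣ v + q * y)]
          refine Finset.sum_congr rfl fun y _ => ?_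
          split_ifs <;> simp
  -- Step 2: each inner sum is bounded by `Bd`
  have hinner : ∀ r ∈ δ.divisors,
      ‖∑ y ∈ (Finset.Ioc y₁ y₂).filter
          (fun y : ℤ => Int.gcd (v + q * y) s = 1 ∧ (r : ℤ) ∣ v + q * y), f (v + q * y)‖ ≤ Bd := by
    intro r hr
    have hr0 : 0 < r := Nat.pos_of_mem_divisors hr
    have hrδ : r ∣ δ := Nat.dvd_of_mem_divisors hr
    by_cases hrs : r.Coprime s
    · -- `(r, s) = 1`: the progression `y ≡ y₀ (mod r)` and `KI_sum_progression_le` with `q r`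
      have hqr : q.Coprime r := (Nat.Coprime.coprime_dvd_left hrδ hδq).symm
      set y₀ : ℤ := -v * ((((q : ZMod r)⁻¹).val : ℕ) : ℤ) with hy₀
      have hfilt : (Finset.Ioc y₁ y₂).filter
            (fun y : ℤ => Int.gcd (v + q * y) s = 1 ∧ (r : ℤ) ∣ v + q * y) =
          (((Finset.Ioc (y₁ - y₀) (y₂ - y₀)).filter (fun y : ℤ => (r : ℤ) ∣ y)).map
              ⟨(· + y₀), add_left_injective y₀⟩).filter
            (fun y : ℤ => Int.gcd (v + q * y) s = 1) := by
        rw [← Int.Ioc_filter_modEq_eq, Finset.filter_filter]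
        refine Finset.filter_congr fun y _ => ?_
        rw [KI_dvd_iff_modEq hr0 hqr, ← hy₀, and_comm]
      have hr0' : (0 : ℤ) < r := by exact_mod_cast hr0
      rw [hfilt, Int.Ioc_filter_dvd_eq _ _ hr0', Finset.map_map, Finset.sum_filter, Finset.sum_map]
      simp only [Function.Embedding.trans_apply, Function.Embedding.coeFn_mk]
      rw [← Finset.sum_filter]
      -- the new progression: `v + q (z r + y₀) = v' + (q r) z`
      set v' : ℤ := v + q * y₀ with hv'
      have hlin : ∀ z : ℤ, v + q * (z * r + y₀) = v' + ((q * r : ℕ) : ℤ) * z := by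
        intro z; rw [hv']; push_cast; ring
      set z₁ : ℤ := ⌊((y₁ - y₀ : ℤ) : ℚ) / (r : ℤ)⌋ with hz₁
      set z₂ : ℤ := ⌊((y₂ - y₀ : ℤ) : ℚ) / (r : ℤ)⌋ with hz₂
      have hz : z₁ ≤ z₂ := by
        rw [hz₁, hz₂]
        refine Int.floor_le_floor (div_le_div_of_nonneg_right ?_ (by exact_mod_cast hr0.le))
        exact_mod_cast (show y₁ - y₀ ≤ y₂ - y₀ by linarith)
      have hz' : ((z₂ - z₁ : ℤ) : ℝ) ≤ ((y₂ - y₁ : ℤ) : ℝ) + 1 := by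
        have h1 : ((z₂ : ℤ) : ℚ) ≤ ((y₂ - y₀ : ℤ) : ℚ) / (r : ℤ) := by rw [hz₂]; exact Int.floor_le _
        have h2 : ((y₁ - y₀ : ℤ) : ℚ) / (r : ℤ) < ((z₁ : ℤ) : ℚ) + 1 := by
          rw [hz₁]; exact Int.lt_floor_add_one _
        have hr1 : (1 : ℚ) ≤ (r : ℤ) := by exact_mod_cast hr0
        have hrpos : (0 : ℚ) < (r : ℤ) := by linarith
        have h3 : ((z₂ - z₁ : ℤ) : ℚ) ≤ ((y₂ - y₁ : ℤ) : ℚ) + 1 := by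
          have h4 : ((y₂ - y₀ : ℤ) : ℚ) / (r : ℤ) - ((y₁ - y₀ : ℤ) : ℚ) / (r : ℤ) =
              ((y₂ - y₁ : ℤ) : ℚ) / (r : ℤ) := by push_cast; ring
          have h5 : ((y₂ - y₁ : ℤ) : ℚ) / (r : ℤ) ≤ ((y₂ - y₁ : ℤ) : ℚ) := by
            rw [div_le_iff₀ hrpos]
            have : (0 : ℚ) ≤ ((y₂ - y₁ : ℤ) : ℚ) := by exact_mod_cast (sub_nonneg.mpr hy)
            nlinarith
          push_cast at h1 h2 h4 h5 ⊢
          linarith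
        have h6 : (((z₂ - z₁ : ℤ) : ℚ) : ℝ) ≤ ((((y₂ - y₁ : ℤ) : ℚ) + 1 : ℚ) : ℝ) := by
          exact_mod_cast h3
        push_cast at h6 ⊢
        exact h6
      have hqrs : (q * r).Coprime s := Nat.Coprime.mul_left hqs hrs
      have key := KI_sum_progression_le hs hqrs a v' z₁ z₂ hz
      have hsum : ∑ z ∈ (Finset.Ioc z₁ z₂).filter (fun z : ℤ => Int.gcd (v + q * (z * r + y₀)) s = 1),
            f (v + q * (z * r + y₀)) =
          ∑ z ∈ (Finset.Ioc z₁ z₂).filter (fun z : ℤ => Int.gcd (v' + ((q * r : ℕ) : ℤ) * z) s = 1),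
            f (v' + ((q * r : ℕ) : ℤ) * z) := by
        rw [Finset.filter_congr (fun z _ => by rw [hlin z])]
        exact Finset.sum_congr rfl fun z _ => by rw [hlin z]
      rw [hsum]
      refine key.trans ?_
      rw [hBd, hW]
      gcongr
    · -- `(r, s) > 1`: the inner sum is empty
      have hempty : (Finset.Ioc y₁ y₂).filter
          (fun y : ℤ => Int.gcd (v + q * y) s = 1 ∧ (r : ℤ) ∣ v + q * y) = ∅ := by
        refine Finset.filter_false_of_mem fun y _ => ?_
        rintro ⟨h1, h2⟩
        apply hrs
        -- `gcd(r, s) ∣ v + qy` and `∣ s`, so it divides `gcd(v + qy, s) = 1`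
        have h3 : ((Nat.gcd r s : ℕ) : ℤ) ∣ v + q * y :=
          Int.dvd_trans (Int.natCast_dvd_natCast.mpr (Nat.gcd_dvd_left r s)) h2
        have h4 : (Nat.gcd r s : ℤ) ∣ (Int.gcd (v + q * y) s : ℤ) :=
          Int.dvd_coe_gcd h3 (Int.natCast_dvd_natCast.mpr (Nat.gcd_dvd_right r s))
        rw [h1] at h4
        have h5 : Nat.gcd r s ∣ 1 := by exact_mod_cast h4
        exact Nat.eq_one_of_dvd_one h5
      rw [hempty, Finset.sum_empty, norm_zero]
      exact hBd0
  -- Step 3: assemble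
  have hf' : ∀ y : ℤ, Complex.exp (2 * Real.pi * Complex.I *
      ((a : ℂ) * (((((v + q * y : ℤ) : ZMod s)⁻¹).val : ℕ) : ℂ) / (s : ℂ))) = f (v + q * y) :=
    fun y => rfl
  simp_rw [hf']
  rw [hstep1]
  calc ‖∑ r ∈ δ.divisors, (ArithmeticFunction.moebius r : ℂ) *
        ∑ y ∈ (Finset.Ioc y₁ y₂).filter
          (fun y : ℤ => Int.gcd (v + q * y) s = 1 ∧ (r : ℤ) ∣ v + q * y), f (v + q * y)‖
      ≤ ∑ r ∈ δ.divisors, ‖(ArithmeticFunction.moebius r : ℂ) *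
        ∑ y ∈ (Finset.Ioc y₁ y₂).filter
          (fun y : ℤ => Int.gcd (v + q * y) s = 1 ∧ (r : ℤ) ∣ v + q * y), f (v + q * y)‖ :=
        norm_sum_le _ _
    _ ≤ ∑ r ∈ δ.divisors, Bd := by
        refine Finset.sum_le_sum fun r hr => ?_
        rw [norm_mul]
        have hμ : ‖(ArithmeticFunction.moebius r : ℂ)‖ ≤ 1 := by
          rw [Complex.norm_intCast]
          exact_mod_cast ArithmeticFunction.abs_moebius_le_one
        calc ‖(ArithmeticFunction.moebius r : ℂ)‖ * _ ≤ 1 * Bd :=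
              mul_le_mul hμ (hinner r hr) (norm_nonneg _) zero_le_one
          _ = Bd := one_mul _
    _ = (Nat.divisors δ).card * Bd := by rw [Finset.sum_const, nsmul_eq_mul]

end Literature.NumberTheory.LFunctions

end
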